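import Summits.QuantumFields.YangMills.Theorems.BalabanUVNodesN07AliasSumMarginSharpCore
import Summits.QuantumFields.YangMills.Theorems.BalabanUVNodesN07AliasSumMarginSharpGrid
import HarnessLib

/-!
# DAG node N07 (road R0′ at the record; the `hker` ∕ `hpos` letter) — THE SHARP ONE-LEVEL MARGIN, part 3:
# «K₀(θ) ≤ K(θ)» — the CENTRE form dominates the MATCHED form with constant ONE, for EVERY odd block side `L ≥ 3`

Width seat `pub-ymgap-dag-n07-w7` (g5), `--supports stmt-QuantumFields-27364 --as helper`; count-neutral; 0 `def`.
Road item (L1) of dag-n07-w5's `LOCATED-PD-LOCALIZATION-ROAD.md` §3 with the SHARP constant: this lineage landed `K₀(θ) ≤ π^{|J|}·K(θ)`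
(g4, `…N07AliasSumMargin.matchedSymbol_le_aliasSymbolK`), dag-n07-w5 g2 the constant `1` at `L = 3` (`…SharpSmallL`); both desks' located
notes (`LOCATED-SHARP-MARGIN` §5, `LOCATED-SHARP-CENTRE-DOMINANCE` §3) recorded the constant `1` numerically for every odd `L` and left it OPEN.

THE PROOF (per coordinate; `x_j = α + jπ∕L`, `α = ϑ∕(2L)`, `ψ = ϑ∕2`, `ℓ_j = (−1)^j sin ψ∕(L sin x_j)`, `y_j = sin² x_j`, `Y_d = sin²(dπ∕L)`):
(A) `ℓ_j − ℓ_j² = (sin²ψ∕L²)·Σ_{m<2c} (−1)^m cos((m+1)π∕L)∕(Y_{m+1} − y_j)` (part 2, `dirichletWeight_sub_sq`: the alternating cosecant identity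
regrouped in pairs); (B) `Σ_j (Y_d − y_j)⁻¹ = 0` (part 2, `sum_inv_nodeSub_eq_zero`); hence
`Σ_j (ℓ_j − ℓ_j²) G(y_j) = (2 sin²ψ∕L²)·Σ_{d=1}^{c} (−1)^{d+1} cos(dπ∕L)·Σ_j [G(y_j) − G(Y_d)]∕(Y_d − y_j)` (the sum over `m < 2c` folds by
the symmetry `m ↦ 2c−1−m`), each inner summand a NEGATED SECANT SLOPE of `G` from the node `Y_d`: `≥ 0` when `G` is non-increasing and
NON-INCREASING IN `d` when `G` is convex (`Y_d` increases, `cos(dπ∕L)` decreases and stays `≥ 0` for `d ≤ c`), so the alternating sum is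
`≥ 0` (part 1, `centreMinusMatched_nonneg`).  CONVEXITY is what is needed — not complete monotonicity — and it IS needed (for `L ≥ 5` the
inequality fails for step profiles); `iterMono 2` functions are convex (part 1, `secant_of_iterMono_two`).

WHAT.  ★★ `centreMinusMatched_nonneg_grid` (`0 ≤ Σ_j (ℓ_j − ℓ_j²) G(sin² x_j)`, `G ∈ iterMono 2`, every odd `L`); ★★★ `sineAlias_domination_sharp`
(`(sin(ϑ∕2)∕L)·Σ_{m<L} G(x+s_m²)∕s_m² ≤ transfer L s G x` — g4's `sineAlias_domination` without `1∕π`, dag-n07-w5's `…_sharp_three` for all odd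
`L ≥ 3`); ★★★ `aliasSum_margin_sharp` (`(Π_κ sin(θ_κ∕2))·B ≤ L^{|J|}·A`, via part 1's `aliasCore_margin_of_order` at order `2`);
★★★ `matchedSymbol_le_aliasSymbolK_sharp` («`K₀(θ) ≤ K(θ)`» in the display of `aliasSymbolK_pos`, NO `π`) and `…_sharp'` (with `0 < K(θ)`).

HONEST SCOPE.  Elementary real analysis ∕ trigonometry on finite alias sums ([folklore] throughout); nothing of [B11]∕[B6]∕[3] is
asserted; road items (L2) (discrete Caccioppoli), (L4) (assembly) and the multi-level `(P)_D` stay OPEN; `hker`, stub 1, K0⁷∕K1⁹ NOT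
closed; N07 not discharged; nothing continuum ∕ OS ∕ mass gap ∕ Clay.  Context: T. Bałaban, CMP **96** (1984) 223–250
[Balaban1984PropagatorsII] (2.22) p.226; CMP **109** (1987) [Balaban1987RG1] (0.4) p.253 — nothing is cited as a hypothesis.
-/

set_option autoImplicit false

noncomputable section

open Finset

namespace Summit.QuantumFields.YangMills.Theorems.N07AliasSumMarginSharp

open Summit.QuantumFields.YangMills.Theorems.N07AliasSumPositivity
open Summit.QuantumFields.YangMills.Theorems.N07AliasSumMargin

/-! ## §6  The sharp one-coordinate domination and the sharp margin, every odd block side -/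

section Sharp

open Real

/-- ★★ **Centre minus matched is non-negative on the shifted grid (every odd `L = 2c+1`).**  For `0 < α < π∕L`, nodes `x_j = α + jπ∕L`,
Dirichlet weights `ℓ_j = (−1)^j sin(Lα) ∕ (L sin x_j)` and `G ∈ iterMono 2`:
`0 ≤ Σ_{j<L} (ℓ_j − ℓ_j²) · G(sin² x_j)` — `dirichletWeight_sub_sq` turns the weights into `(sin²(Lα)∕L²)·Σ_{m<2c} (−1)^m cos((m+1)π∕L)∕(Y_{m+1} − y_j)`,
the sum over `m < 2c` folds onto `m < c` (the summand is invariant under `m ↦ 2c−1−m`: `cos(π − u) = −cos u`, `sin(π − u) = sin u`, odd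
total sign), and `centreMinusMatched_nonneg` applies with `Y_d = sin²(dπ∕L)` (increasing, `d ≤ c`), `κ_d = cos(dπ∕L)` (non-negative,
non-increasing) and the vanishing alias sums `sum_inv_nodeSub_eq_zero`. [folklore] -/
theorem centreMinusMatched_nonneg_grid {c L : ℕ} (hcL : 2 * c + 1 = L) {α : ℝ} (h0 : 0 < α) (h1 : α < π / L)
    {G : ℝ → ℝ} (hG : G ∈ iterMono 2) :
    0 ≤ ∑ j ∈ range L, ((-1 : ℝ) ^ j * sin (L * α) / (L * sin (α + j * (π / L)))
        - ((-1 : ℝ) ^ j * sin (L * α) / (L * sin (α + j * (π / L)))) ^ 2) * G (sin (α + j * (π / L)) ^ 2) := by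
  have hL0 : 0 < L := by omega
  have hLr : (0 : ℝ) < L := by exact_mod_cast hL0
  have hLne : (L : ℝ) ≠ 0 := hLr.ne'
  have hLc : (L : ℝ) = 2 * c + 1 := by exact_mod_cast hcL.symm
  have hπL : 0 < π / L := div_pos pi_pos hLr
  -- node sums
  set Ψ : ℕ → ℝ := fun d => ∑ j ∈ range L, G (sin (α + j * (π / L)) ^ 2)
      / (sin (d * (π / L)) ^ 2 - sin (α + j * (π / L)) ^ 2) with hΨ
  set φ : ℕ → ℝ := fun m => (-1 : ℝ) ^ m * (cos ((m + 1 : ℕ) * (π / L)) * Ψ (m + 1)) with hφ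
  -- step 1: the weight identity and the swap of the two sums
  have step1 : ∑ j ∈ range L, ((-1 : ℝ) ^ j * sin (L * α) / (L * sin (α + j * (π / L)))
        - ((-1 : ℝ) ^ j * sin (L * α) / (L * sin (α + j * (π / L)))) ^ 2) * G (sin (α + j * (π / L)) ^ 2)
      = sin (L * α) ^ 2 / (L : ℝ) ^ 2 * ∑ m ∈ range (2 * c), φ m := by
    calc ∑ j ∈ range L, ((-1 : ℝ) ^ j * sin (L * α) / (L * sin (α + j * (π / L)))
          - ((-1 : ℝ) ^ j * sin (L * α) / (L * sin (α + j * (π / L)))) ^ 2) * G (sin (α + j * (π / L)) ^ 2)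
        = ∑ j ∈ range L, sin (L * α) ^ 2 / (L : ℝ) ^ 2 * ∑ m ∈ range (2 * c),
            (-1 : ℝ) ^ m * cos ((m + 1 : ℕ) * (π / L))
              / (sin ((m + 1 : ℕ) * (π / L)) ^ 2 - sin (α + j * (π / L)) ^ 2) * G (sin (α + j * (π / L)) ^ 2) := by
          refine sum_congr rfl (fun j _ => ?_)
          rw [dirichletWeight_sub_sq hcL h0 h1 j, mul_assoc, sum_mul]
      _ = sin (L * α) ^ 2 / (L : ℝ) ^ 2 * ∑ m ∈ range (2 * c), ∑ j ∈ range L,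
            (-1 : ℝ) ^ m * cos ((m + 1 : ℕ) * (π / L))
              / (sin ((m + 1 : ℕ) * (π / L)) ^ 2 - sin (α + j * (π / L)) ^ 2) * G (sin (α + j * (π / L)) ^ 2) := by
          rw [← mul_sum, sum_comm]
      _ = sin (L * α) ^ 2 / (L : ℝ) ^ 2 * ∑ m ∈ range (2 * c), φ m := by
          congr 1
          refine sum_congr rfl (fun m _ => ?_)
          simp only [hφ, hΨ]
          rw [mul_sum, mul_sum]
          refine sum_congr rfl (fun j _ => ?_)
          ring
  -- step 2: the reflection symmetry `φ (2c−1−m) = φ m`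
  have hsymm : ∀ m, m < 2 * c → φ (2 * c - 1 - m) = φ m := by
    intro m hm
    simp only [hφ]
    have hk : 2 * c - 1 - m + 1 = 2 * c - m := by omega
    rw [hk]
    have hcast : ((2 * c - m : ℕ) : ℝ) = 2 * c - m := by
      rw [Nat.cast_sub (by omega)]; push_cast; ring
    have hangle : ((2 * c - m : ℕ) : ℝ) * (π / L) = π - ((m + 1 : ℕ) : ℝ) * (π / L) := by
      rw [hcast, hLc]; push_cast; field_simp; ring
    have hΨs : Ψ (2 * c - m) = Ψ (m + 1) := by
      simp only [hΨ]
      refine sum_congr rfl (fun j _ => ?_)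
      rw [hangle, sin_pi_sub]
    have hcos : cos (((2 * c - m : ℕ) : ℝ) * (π / L)) = -cos (((m + 1 : ℕ) : ℝ) * (π / L)) := by
      rw [hangle, cos_pi_sub]
    have hsgn : (-1 : ℝ) ^ (2 * c - 1 - m) = -(-1 : ℝ) ^ m := by
      have h1' : (-1 : ℝ) ^ (2 * c - 1 - m) * (-1 : ℝ) ^ m = -1 := by
        rw [← pow_add, show 2 * c - 1 - m + m = 2 * (c - 1) + 1 by omega, pow_succ, pow_mul]; norm_num
      have h2' : (-1 : ℝ) ^ m * (-1 : ℝ) ^ m = 1 := by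
        rw [← pow_add, ← two_mul, pow_mul]; norm_num
      calc (-1 : ℝ) ^ (2 * c - 1 - m) = (-1 : ℝ) ^ (2 * c - 1 - m) * ((-1 : ℝ) ^ m * (-1 : ℝ) ^ m) := by
            rw [h2', mul_one]
        _ = ((-1 : ℝ) ^ (2 * c - 1 - m) * (-1 : ℝ) ^ m) * (-1 : ℝ) ^ m := by ring
        _ = -(-1 : ℝ) ^ m := by rw [h1']; ring
    rw [hΨs, hcos, hsgn]
    ring
  -- step 3: the abstract core
  have hcore : 0 ≤ ∑ d ∈ range c, (-1 : ℝ) ^ d * (cos ((d + 1 : ℕ) * (π / L)) * Ψ (d + 1)) := by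
    refine centreMinusMatched_nonneg (L := L) (c := c) (fun j => sin (α + j * (π / L)) ^ 2)
      (fun d => sin (d * (π / L)) ^ 2) (fun d => cos (d * (π / L))) ?_ ?_ ?_ ?_ ?_ ?_ ?_ hG
    · intro j _
      have h := sin_grid_ne_zero hL0 h0 h1 j
      positivity
    · intro d hd1 hdc
      have hdpos : (0 : ℝ) < d := by exact_mod_cast (show 0 < d by omega)
      have hlt : (d : ℝ) * (π / L) < π := by
        have hd' : (d : ℝ) < L := by exact_mod_cast (show d < L by omega)
        have h' : (d : ℝ) * (π / L) < L * (π / L) := mul_lt_mul_of_pos_right hd' hπL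
        have e : (L : ℝ) * (π / L) = π := by field_simp
        linarith
      have := sin_pos_of_pos_of_lt_pi (by positivity) hlt
      positivity
    · intro d d' hd1 hdd' hd'c
      have hle2 : (d' : ℝ) * (π / L) ≤ π / 2 := by
        have hd' : (2 * d' : ℝ) ≤ L := by exact_mod_cast (show 2 * d' ≤ L by omega)
        have h' : (2 * d' : ℝ) * (π / L) ≤ L * (π / L) := mul_le_mul_of_nonneg_right hd' hπL.le
        have e : (L : ℝ) * (π / L) = π := by field_simp
        linarith
      have hdd : (d : ℝ) * (π / L) ≤ d' * (π / L) :=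
        mul_le_mul_of_nonneg_right (by exact_mod_cast hdd') hπL.le
      have h0d : 0 ≤ (d : ℝ) * (π / L) := by positivity
      have hs := sin_le_sin_of_le_of_le_pi_div_two (by linarith) hle2 hdd
      have hs0 : 0 ≤ sin ((d : ℝ) * (π / L)) :=
        sin_nonneg_of_nonneg_of_le_pi h0d (by linarith)
      exact pow_le_pow_left₀ hs0 hs 2
    · intro d j hd1 hdc _ h
      exact nodeSub_ne_zero h0 h1 hd1 (by omega) j (by rw [h]; ring)
    · intro d hd1 hdc
      have hle2 : (d : ℝ) * (π / L) ≤ π / 2 := by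
        have hd' : (2 * d : ℝ) ≤ L := by exact_mod_cast (show 2 * d ≤ L by omega)
        have h' : (2 * d : ℝ) * (π / L) ≤ L * (π / L) := mul_le_mul_of_nonneg_right hd' hπL.le
        have e : (L : ℝ) * (π / L) = π := by field_simp
        linarith
      have h0d : 0 ≤ (d : ℝ) * (π / L) := by positivity
      exact cos_nonneg_of_neg_pi_div_two_le_of_le (by linarith) hle2
    · intro d d' hd1 hdd' hd'c
      have hleπ : (d' : ℝ) * (π / L) ≤ π := by
        have hd' : (d' : ℝ) ≤ L := by exact_mod_cast (show d' ≤ L by omega)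
        have h' : (d' : ℝ) * (π / L) ≤ L * (π / L) := mul_le_mul_of_nonneg_right hd' hπL.le
        have e : (L : ℝ) * (π / L) = π := by field_simp
        linarith
      have hdd : (d : ℝ) * (π / L) ≤ d' * (π / L) :=
        mul_le_mul_of_nonneg_right (by exact_mod_cast hdd') hπL.le
      have h0d : 0 ≤ (d : ℝ) * (π / L) := by positivity
      exact cos_le_cos_of_nonneg_of_le_pi h0d hleπ hdd
    · intro d hd1 hdc
      exact sum_inv_nodeSub_eq_zero hcL h0 h1 hd1 hdc
  rw [step1, sum_range_two_mul_of_symm c φ hsymm]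
  have hS : 0 ≤ sin (L * α) ^ 2 / (L : ℝ) ^ 2 := by positivity
  exact mul_nonneg hS (mul_nonneg (by norm_num) hcore)

/-- ★★★ **SHARP one-coordinate domination for EVERY odd block side `L ≥ 3`**: for `ϑ ∈ (0,2π)`, `s_m = sin((ϑ+2πm)∕(2L))`, `G` positive,
non-increasing and CONVEX on `(0,∞)` in the finite-difference sense (`G ∈ iterMono 2`) and `x ≥ 0`,
`(sin(ϑ∕2)∕L) · Σ_{m<L} G(x+s_m²)∕s_m² ≤ transfer L s G x = Σ_{m<L} (−1)^m G(x+s_m²)∕s_m` — the domination constant `w = sin(ϑ∕2)∕L`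
WITHOUT this lineage's factor `1∕π` (`sineAlias_domination`, g4) and for every odd `L` (dag-n07-w5 g2's `sineAlias_domination_sharp_three`
is `L = 3`): per coordinate the CENTRE form dominates the MATCHED form with constant ONE.  It is `centreMinusMatched_nonneg_grid` for the
translate `u ↦ G(u + x)` at `α = ϑ∕(2L)`: `Σ_j ℓ_j G_j = (sin(ϑ∕2)∕L)·transfer`, `Σ_j ℓ_j² G_j = (sin(ϑ∕2)∕L)²·matched`.  Convexity is
NECESSARY here for `L ≥ 5` (the step profiles violate the inequality — located notes of both desks), so `iterMono 1` would not do. [folklore] -/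
theorem sineAlias_domination_sharp {L : ℕ} (hL : Odd L) (h3 : 3 ≤ L) {ϑ : ℝ} (h0 : 0 < ϑ) (h1 : ϑ < 2 * π)
    {G : ℝ → ℝ} (hG : G ∈ iterMono 2) {x : ℝ} (hx : 0 ≤ x) :
    sin (ϑ / 2) / L * ∑ m ∈ range L, G (x + sin ((ϑ + 2 * π * m) / (2 * L)) ^ 2) / sin ((ϑ + 2 * π * m) / (2 * L)) ^ 2
      ≤ transfer L (fun m => sin ((ϑ + 2 * π * m) / (2 * L))) G x := by
  obtain ⟨c, hc⟩ := hL
  have hL0 : 0 < L := by omega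
  have hLr : (0 : ℝ) < L := by exact_mod_cast hL0
  have hLne : (L : ℝ) ≠ 0 := hLr.ne'
  set α : ℝ := ϑ / (2 * L) with hα
  have earg : ∀ m : ℕ, (ϑ + 2 * π * m) / (2 * L) = α + m * (π / L) := fun m => aliasAngle_eq_grid ϑ hL0 m
  have eψ : ϑ / 2 = L * α := by rw [hα]; field_simp
  have h0' : 0 < α := by rw [hα]; positivity
  have h1' : α < π / L := by
    rw [hα, div_lt_div_iff₀ (by positivity) hLr]
    nlinarith
  have hsinψ : 0 < sin (L * α) := by
    rw [← eψ]; exact sin_pos_of_pos_of_lt_pi (by linarith) (by linarith)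
  -- the translate `u ↦ G (u + x)` is again `iterMono 2`
  have hGx : (fun u => G (u + x)) ∈ iterMono 2 := iterMono_translate hx hG
  have key := centreMinusMatched_nonneg_grid hc.symm h0' h1' hGx
  unfold transfer
  simp only [earg, eψ]
  -- split the grid sum into the centre and the matched parts
  set S : ℝ := sin (L * α) with hS
  have hsplit : ∑ j ∈ range L, ((-1 : ℝ) ^ j * S / (L * sin (α + j * (π / L)))
        - ((-1 : ℝ) ^ j * S / (L * sin (α + j * (π / L)))) ^ 2) * (fun u => G (u + x)) (sin (α + j * (π / L)) ^ 2)
      = S / L * (∑ j ∈ range L, (-1 : ℝ) ^ j / sin (α + j * (π / L)) * G (x + sin (α + j * (π / L)) ^ 2))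
        - S / L * (S / L * ∑ j ∈ range L,
            G (x + sin (α + j * (π / L)) ^ 2) / sin (α + j * (π / L)) ^ 2) := by
    rw [mul_sum, mul_sum, mul_sum, ← sum_sub_distrib]
    refine sum_congr rfl (fun j _ => ?_)
    have hs : sin (α + j * (π / L)) ≠ 0 := sin_grid_ne_zero hL0 h0' h1' j
    set s : ℝ := sin (α + j * (π / L)) with hsdef
    have hε : ((-1 : ℝ) ^ j) ^ 2 = 1 := by rw [← pow_mul, mul_comm, pow_mul]; norm_num
    simp only
    rw [add_comm (s ^ 2) x, div_pow, mul_pow, hε, one_mul]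
    field_simp
  rw [hsplit, ← mul_sub] at key
  have key' : 0 ≤ (∑ j ∈ range L, (-1 : ℝ) ^ j / sin (α + j * (π / L)) * G (x + sin (α + j * (π / L)) ^ 2))
      - S / L * ∑ j ∈ range L, G (x + sin (α + j * (π / L)) ^ 2) / sin (α + j * (π / L)) ^ 2 :=
    (mul_nonneg_iff_of_pos_left (div_pos hsinψ hLr)).mp key
  linarith

/-- ★★★ **THE SHARP ONE-LEVEL MARGIN, every finite set of coordinates, every odd block side `L ≥ 3`** (this lineage's `aliasSum_margin`
with `(πL)^{|J|}` replaced by `L^{|J|}`, dag-n07-w5 g2's `aliasSum_margin_sharp_three` with `L = 3` replaced by every odd `L ≥ 3`): for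
`θ_κ ∈ (0, 2π)` and `s_m(ϑ) = sin((ϑ + 2πm)∕(2L))`,
`(Π_κ sin(θ_κ∕2)) · Σ_{m : J → Fin L} (Π_κ s_{m_κ}(θ_κ)⁻²) ∕ (Σ_κ s_{m_κ}(θ_κ)²)² ≤ L^{|J|} · Σ_m (Π_κ (−1)^{m_κ} ∕ s_{m_κ}(θ_κ)) ∕ (Σ_κ s²)²`
(`aliasCore_margin_of_order` at order `2` with `F = x⁻¹·x⁻¹` and the sharp constants `w_κ = sin(θ_κ∕2)∕L` of `sineAlias_domination_sharp`).
[folklore] -/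
theorem aliasSum_margin_sharp {J : Type*} [Fintype J] [DecidableEq J] {L : ℕ} (hL : Odd L) (h3 : 3 ≤ L) (θ : J → ℝ)
    (hθ : ∀ κ, 0 < θ κ ∧ θ κ < 2 * π) :
    (∏ κ, sin (θ κ / 2)) * ∑ m : J → Fin L,
        (∏ κ, (sin ((θ κ + 2 * π * (m κ : ℕ)) / (2 * L)) ^ 2)⁻¹) /
          (∑ κ, sin ((θ κ + 2 * π * (m κ : ℕ)) / (2 * L)) ^ 2) ^ 2
      ≤ (L : ℝ) ^ Fintype.card J * ∑ m : J → Fin L,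
        (∏ κ, (-1 : ℝ) ^ (m κ : ℕ) / sin ((θ κ + 2 * π * (m κ : ℕ)) / (2 * L))) /
          (∑ κ, sin ((θ κ + 2 * π * (m κ : ℕ)) / (2 * L)) ^ 2) ^ 2 := by
  classical
  have hLpos : (0 : ℝ) < L := by exact_mod_cast (show 0 < L by omega)
  -- the data and the constants
  set s : J → ℕ → ℝ := fun κ m => sin ((θ κ + 2 * π * m) / (2 * L)) with hsdef
  have hs0 : ∀ κ m, m < L → 0 < s κ m := fun κ m hm => sineAlias_pos (hθ κ).1 (hθ κ).2 hm
  have hs : ∀ κ, ∃ p, ((∀ m m', m ≤ m' → m' ≤ p → m' < L → s κ m ≤ s κ m') ∧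
      (∀ m m', p + 1 ≤ m → m ≤ m' → m' < L → s κ m' ≤ s κ m)) :=
    fun κ => sineAlias_hill (hθ κ).1 (hθ κ).2 L
  set w : J → ℝ := fun κ => sin (θ κ / 2) / L with hwdef
  have hsinpos : ∀ κ, 0 < sin (θ κ / 2) := fun κ =>
    sin_pos_of_pos_of_lt_pi (by linarith [(hθ κ).1]) (by linarith [(hθ κ).2])
  have hw0 : ∀ κ, 0 ≤ w κ := fun κ => div_nonneg (hsinpos κ).le hLpos.le
  have hw : ∀ κ (G : ℝ → ℝ), G ∈ iterMono 2 → ∀ x : ℝ, 0 ≤ x →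
      w κ * ∑ m ∈ range L, G (x + s κ m ^ 2) / s κ m ^ 2 ≤ transfer L (s κ) G x :=
    fun κ G hG x hx => sineAlias_domination_sharp hL h3 (hθ κ).1 (hθ κ).2 hG hx
  -- the abstract margin at order `2`, at `x = 0`
  have hcore := aliasCore_margin_of_order hL 2 s hs0 hs w hw0 hw (fun x => x⁻¹ * x⁻¹) iterMono_inv_mul_inv 0 le_rfl
  simp only [zero_add] at hcore
  -- rewrite the two sums of the statement in the abstract shape
  have eB : ∑ m : J → Fin L, (∏ κ, (sin ((θ κ + 2 * π * (m κ : ℕ)) / (2 * L)) ^ 2)⁻¹) /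
        (∑ κ, sin ((θ κ + 2 * π * (m κ : ℕ)) / (2 * L)) ^ 2) ^ 2
      = ∑ m : J → Fin L, (∏ κ, (s κ (m κ) ^ 2)⁻¹) *
          ((∑ κ, s κ (m κ) ^ 2)⁻¹ * (∑ κ, s κ (m κ) ^ 2)⁻¹) := by
    refine Fintype.sum_congr _ _ (fun m => ?_)
    simp only [hsdef, div_eq_mul_inv, sq, mul_inv]
  have eA : ∑ m : J → Fin L, (∏ κ, (-1 : ℝ) ^ (m κ : ℕ) / sin ((θ κ + 2 * π * (m κ : ℕ)) / (2 * L))) /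
        (∑ κ, sin ((θ κ + 2 * π * (m κ : ℕ)) / (2 * L)) ^ 2) ^ 2
      = ∑ m : J → Fin L, (∏ κ, (-1 : ℝ) ^ (m κ : ℕ) / s κ (m κ)) *
          ((∑ κ, s κ (m κ) ^ 2)⁻¹ * (∑ κ, s κ (m κ) ^ 2)⁻¹) := by
    refine Fintype.sum_congr _ _ (fun m => ?_)
    simp only [hsdef, div_eq_mul_inv, sq, mul_inv]
  rw [eB, eA]
  -- the weights: `Π w = (Π sin) ∕ L^{|J|}`
  have hwprod : (∏ κ, w κ) = (∏ κ, sin (θ κ / 2)) / (L : ℝ) ^ Fintype.card J := by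
    rw [hwdef, Finset.prod_div_distrib, Finset.prod_const, Finset.card_univ]
  rw [hwprod, div_mul_eq_mul_div, div_le_iff₀ (by positivity)] at hcore
  linarith [hcore]

/-- ★★★ **«`K₀(θ) ≤ K(θ)`» — the block-MEAN symbol is dominated by the CENTRE-sampling symbol of `aliasSymbolK_pos` with constant ONE,
letter for letter, for every odd block side `L ≥ 3`, every finite set of coordinates and every coarse torus** (this lineage's
`matchedSymbol_le_aliasSymbolK` WITHOUT the factor `π^{|J|}`): for `θ_κ ∈ (0,2π)`,
`L^{−2|J|} Σ_m Π_κ [sin²(θ_κ∕2) ∕ s_{m_κ}(θ_κ)²] · (4 Σ_κ s²)^{−2} ≤ L^{−|J|} Σ_m Π_κ [(−1)^{m_κ} sin(θ_κ∕2) ∕ s_{m_κ}(θ_κ)] · (4 Σ_κ s²)^{−2}` —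
at one averaging level the centre form dominates the matched form OUTRIGHT (dag-n07-w5 `LOCATED-SHARP-CENTRE-DOMINANCE` §0, numerically
located there and in this desk's `LOCATED-SHARP-MARGIN` §2; proved here). [folklore] -/
theorem matchedSymbol_le_aliasSymbolK_sharp {J : Type*} [Fintype J] [DecidableEq J] {L : ℕ} (hL : Odd L) (h3 : 3 ≤ L)
    (θ : J → ℝ) (hθ : ∀ κ, 0 < θ κ ∧ θ κ < 2 * π) :
    ((L : ℝ) ^ (2 * Fintype.card J))⁻¹ * ∑ m : J → Fin L,
        (∏ κ, sin (θ κ / 2) ^ 2 / sin ((θ κ + 2 * π * (m κ : ℕ)) / (2 * L)) ^ 2) /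
          (4 * ∑ κ, sin ((θ κ + 2 * π * (m κ : ℕ)) / (2 * L)) ^ 2) ^ 2
      ≤ ((L : ℝ) ^ Fintype.card J)⁻¹ * ∑ m : J → Fin L,
        (∏ κ, (-1 : ℝ) ^ (m κ : ℕ) * sin (θ κ / 2) / sin ((θ κ + 2 * π * (m κ : ℕ)) / (2 * L))) /
          (4 * ∑ κ, sin ((θ κ + 2 * π * (m κ : ℕ)) / (2 * L)) ^ 2) ^ 2 := by
  have hLpos : (0 : ℝ) < L := by exact_mod_cast (show 0 < L by omega)
  have hsin : 0 ≤ ∏ κ : J, sin (θ κ / 2) :=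
    Finset.prod_nonneg (fun κ _ => (sin_pos_of_pos_of_lt_pi (by linarith [(hθ κ).1])
      (by linarith [(hθ κ).2])).le)
  -- factor the common prefactors out of both symbols
  have keyB : ∀ m : J → Fin L,
      (∏ κ, sin (θ κ / 2) ^ 2 / sin ((θ κ + 2 * π * (m κ : ℕ)) / (2 * L)) ^ 2) /
        (4 * ∑ κ, sin ((θ κ + 2 * π * (m κ : ℕ)) / (2 * L)) ^ 2) ^ 2 =
      ((∏ κ : J, sin (θ κ / 2)) * (∏ κ : J, sin (θ κ / 2)) / 16) *
        ((∏ κ, (sin ((θ κ + 2 * π * (m κ : ℕ)) / (2 * L)) ^ 2)⁻¹) /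
          (∑ κ, sin ((θ κ + 2 * π * (m κ : ℕ)) / (2 * L)) ^ 2) ^ 2) := by
    intro m
    have e : (∏ κ, sin (θ κ / 2) ^ 2 / sin ((θ κ + 2 * π * (m κ : ℕ)) / (2 * L)) ^ 2)
        = (∏ κ : J, sin (θ κ / 2)) * (∏ κ : J, sin (θ κ / 2)) *
          ∏ κ, (sin ((θ κ + 2 * π * (m κ : ℕ)) / (2 * L)) ^ 2)⁻¹ := by
      rw [← Finset.prod_mul_distrib, ← Finset.prod_mul_distrib]
      exact Finset.prod_congr rfl (fun κ _ => by rw [div_eq_mul_inv, sq])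
    rw [e]
    ring
  have keyA : ∀ m : J → Fin L,
      (∏ κ, (-1 : ℝ) ^ (m κ : ℕ) * sin (θ κ / 2) / sin ((θ κ + 2 * π * (m κ : ℕ)) / (2 * L))) /
        (4 * ∑ κ, sin ((θ κ + 2 * π * (m κ : ℕ)) / (2 * L)) ^ 2) ^ 2 =
      ((∏ κ : J, sin (θ κ / 2)) / 16) *
        ((∏ κ, (-1 : ℝ) ^ (m κ : ℕ) / sin ((θ κ + 2 * π * (m κ : ℕ)) / (2 * L))) /
          (∑ κ, sin ((θ κ + 2 * π * (m κ : ℕ)) / (2 * L)) ^ 2) ^ 2) := by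
    intro m
    have e : (∏ κ, (-1 : ℝ) ^ (m κ : ℕ) * sin (θ κ / 2) / sin ((θ κ + 2 * π * (m κ : ℕ)) / (2 * L)))
        = (∏ κ : J, sin (θ κ / 2)) *
          ∏ κ, (-1 : ℝ) ^ (m κ : ℕ) / sin ((θ κ + 2 * π * (m κ : ℕ)) / (2 * L)) := by
      rw [← Finset.prod_mul_distrib]
      exact Finset.prod_congr rfl (fun κ _ => by ring)
    rw [e]
    ring
  simp only [keyB, keyA, ← Finset.mul_sum]
  have hmar := aliasSum_margin_sharp hL h3 θ hθ
  -- abbreviate the two core sums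
  set A := ∑ m : J → Fin L,
    (∏ κ, (-1 : ℝ) ^ (m κ : ℕ) / sin ((θ κ + 2 * π * (m κ : ℕ)) / (2 * L))) /
      (∑ κ, sin ((θ κ + 2 * π * (m κ : ℕ)) / (2 * L)) ^ 2) ^ 2 with hA
  set B := ∑ m : J → Fin L, (∏ κ, (sin ((θ κ + 2 * π * (m κ : ℕ)) / (2 * L)) ^ 2)⁻¹) /
      (∑ κ, sin ((θ κ + 2 * π * (m κ : ℕ)) / (2 * L)) ^ 2) ^ 2 with hB
  set P := ∏ κ : J, sin (θ κ / 2) with hP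
  have hLJ : (0 : ℝ) < (L : ℝ) ^ Fintype.card J := by positivity
  -- multiply the core margin by `P ∕ (16 L^{2|J|}) ≥ 0`
  have h1 : ((L : ℝ) ^ (2 * Fintype.card J))⁻¹ * (P * P / 16 * B)
      = (P / 16 * ((L : ℝ) ^ (2 * Fintype.card J))⁻¹) * (P * B) := by ring
  have h2 : ((L : ℝ) ^ Fintype.card J)⁻¹ * (P / 16 * A)
      = (P / 16 * ((L : ℝ) ^ (2 * Fintype.card J))⁻¹) * ((L : ℝ) ^ Fintype.card J * A) := by
    have hx : ((L : ℝ) ^ Fintype.card J)⁻¹ * (L : ℝ) ^ Fintype.card J = 1 := inv_mul_cancel₀ hLJ.ne'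
    rw [pow_mul', sq, mul_inv]
    linear_combination (-(P / 16 * A * ((L : ℝ) ^ Fintype.card J)⁻¹)) * hx
  rw [h1, h2]
  exact mul_le_mul_of_nonneg_left hmar (by positivity)

/-- The same with the positivity of the centre symbol recorded: for a finite NON-EMPTY `J`, `0 < K(θ)` (`aliasSymbolK_pos`) and
`K₀(θ) ≤ K(θ)`, so the true one-level ratio satisfies `K(θ)∕K₀(θ) ≥ 1` — uniformly in `L`, `|J|` and the coarse torus. [folklore] -/
theorem matchedSymbol_le_aliasSymbolK_sharp' {J : Type*} [Fintype J] [DecidableEq J] [Nonempty J] {L : ℕ} (hL : Odd L)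
    (h3 : 3 ≤ L) (θ : J → ℝ) (hθ : ∀ κ, 0 < θ κ ∧ θ κ < 2 * π) :
    0 < ((L : ℝ) ^ Fintype.card J)⁻¹ * ∑ m : J → Fin L,
        (∏ κ, (-1 : ℝ) ^ (m κ : ℕ) * sin (θ κ / 2) / sin ((θ κ + 2 * π * (m κ : ℕ)) / (2 * L))) /
          (4 * ∑ κ, sin ((θ κ + 2 * π * (m κ : ℕ)) / (2 * L)) ^ 2) ^ 2 ∧
    ((L : ℝ) ^ (2 * Fintype.card J))⁻¹ * ∑ m : J → Fin L,
        (∏ κ, sin (θ κ / 2) ^ 2 / sin ((θ κ + 2 * π * (m κ : ℕ)) / (2 * L)) ^ 2) /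
          (4 * ∑ κ, sin ((θ κ + 2 * π * (m κ : ℕ)) / (2 * L)) ^ 2) ^ 2
      ≤ ((L : ℝ) ^ Fintype.card J)⁻¹ * ∑ m : J → Fin L,
        (∏ κ, (-1 : ℝ) ^ (m κ : ℕ) * sin (θ κ / 2) / sin ((θ κ + 2 * π * (m κ : ℕ)) / (2 * L))) /
          (4 * ∑ κ, sin ((θ κ + 2 * π * (m κ : ℕ)) / (2 * L)) ^ 2) ^ 2 :=
  ⟨aliasSymbolK_pos hL θ hθ, matchedSymbol_le_aliasSymbolK_sharp hL h3 θ hθ⟩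

end Sharp

end Summit.QuantumFields.YangMills.Theorems.N07AliasSumMarginSharp

end
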